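import Literature.MathematicalPhysics.QuantumFieldTheory.Balaban1983to89.B8Ineq159CurvedCubeMemberLocalTower
import Literature.MathematicalPhysics.QuantumFieldTheory.Balaban1983to89.B8Ineq159CurvedCubeMemberInAk

/-!
# `Balaban1983to89.B8Ineq159CurvedCubeMemberSmallPlaquettesTower` — [Balaban1985RegularSpaces] (1.59) p. 86 AT A SMALL-FIELD BACKGROUND ON THE CUBE MEMBER,
# PER MEMBER, ALL TRUNCATIONS `1 ≤ m ≤ k`: plaquettes `a₀(□, m)`-small on a box around `□₀` (p. 77's (1.7), read through Lemma 1 p. 79's axial gauge and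
# [Balaban1985Averaging] Prop. 2's averaging-closed regime) ⟹ the curved (1.59) data dominate `|φ|, |D^η_{U₀}φ|, |Δ^η_{U₀}φ|` on the sides of every `□_j`

statement-level skeleton of published theorems with citation tags; proofs where landed; nothing here is a claim about the
Yang–Mills mass gap

`[Balaban1985RegularSpaces]` ("B8", CMP **99** (1985) 75–102) p. 77 (`𝔄_k({Ω_j}, α₀)`, (1.7)), (1.11) p. 78, Lemma 1 p. 79, (1.27)–(1.29) p. 81, (1.38) p. 82,
(1.59) p. 86, (1.62) p. 87, p. 98, (1.131) p. 99; [B7] = `[Balaban1985Averaging]` (CMP **98** (1985) 17–51) (8), (11) pp. 18–19, p. 24, (42)–(43) pp. 23–24,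
Prop. 2 (52)–(54) p. 26; [4] = `[Balaban1985BackgroundPropagators]` (3.32) p. 395, Thm 3.3 p. 399.

CITATION HEADER (lean-in-tree rule).  Cell `pub-ymgap` (YM Track A, HUMAN RULING D-0062 ∕ D-0149), DAG node N05 = [B8], width seat `pub-ymgap-dag-n05-w3`
(g2), CLAIM-1 file (G′), INTENT-13 — the all-truncations twin of file (G).  WHY.  (G) is truncation `m = 1` (it rests on (D) via (F)); the all-truncations
theorem (D′) lives in [B7] Prop. 2's regime (`2 ≤ L`, background valued in an averaging-closed group `G`), localised by (F′)
(`B8Ineq159CurvedCubeMemberLocalTower.exists_curved159_perCube_local`, box `□₀ + (Lᵐ+3)`).  THIS FILE transports (F′) along gauge transformations ((E)'s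
covariance lemmas BY NAME) and feeds it Lemma 1's axial gauge (`B8Lemma1NonAbelian.axial_bond_bound_sharp` BY NAME), then re-keys to print's class `𝔄_k`
(`B8Ineq132.InAk`, file (H)'s bridge) and to unitary backgrounds of C⋆-algebras (`B7Prop2Explicit.avgClosed_unitaryUnits`).

THE MATHEMATICS (kernel-checked).  §1 ★ `exists_curved159_perCube_local_gauge`: (F′) at the background `V^u`, `u` unit-bounded, `V` `G`-valued and `δ₀`-close
to `1` on the box.  §2 ★★★ `exists_curved159_perCube_smallPlaquettes_tower`: THERE ARE `a₀(□, m) > 0`, `B′(□, m) > 0` such that for every `G`-valued `U₀` with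
`‖U₀(∂p) − 1‖ ≤ a₀` for the plaquettes of `[sqLo₀ − (Lᵐ+4)𝟙, sqHi₀ + (Lᵐ+4)𝟙]`, every `φ` in the curved Landau gauge (1.38) of `U₀` at truncation `m` with the
support clause, and every `N ≥ 0` bounding the curved data (i)–(iii), `(Lʲη)|φ|, (Lʲη)²|D^η_{U₀,ν}φ_τ|, (Lʲη)³|Δ^η_{U₀}φ_τ| ≤ B′N` on the sides of `□_j`, `j ≤ m`
(the axial gauge function `U₀(Γ_{lo,x})` is `G`-valued, `B7Prop2Explicit.hol_mem_of`; `U₀^{w}` is `G`-valued, `B8Eq115GaugeFixing.gaugeAct_mem_of`, and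
`l1(box)·a₀ ≤ δ₀`-close to `1` on the box; `U₀ = (U₀^w)^{w⁻¹}`; §1).  §3 ★ `exists_curved159_perCube_inAk_tower`: the same for `U₀ ∈ 𝔄_{k′}({Ω_j}, α₀)` with
`Ω₀ ⊇ □₀ + (Lᵐ+4)` (file (H)'s `plaqSmall_of_inAk`); ★ `exists_curved159_perCube_unitary_smallPlaquettes` ∕ `exists_curved159_perCube_unitary_inAk`: the
C⋆-algebra specialisations at `G := U(𝔸)`.

HONEST SCOPE ∕ A6.  PER MEMBER AND PER TRUNCATION: `a₀, α₀, B′` depend on `(□, m)` and `𝔸`, NOT explicit, NOT print's uniform constants; the plaquette box is a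
NEIGHBOURHOOD of `Ω₀ = □₀` (margin `Lᵐ + 4`) — print's `𝔄_k({□_j}, α₀)` constrains only the plaquettes touching the `Ω_j` (with level weights), so §3 needs the
located side condition «`Ω₀ ⊇` the box» and uses only the level-`0` plaquette clause of (1.7); `G`-valuedness on all of `ℤᵈ`; `2 ≤ L ≤ ρ`; NOT an inhabitant
of `SockB9P3` ∕ `SockH59` ∕ `CurvAtInAk` as typed; nothing of [4] Thm 3.3's uniformity or random-walk expansion; NOT N06's object layer.  Non-vacuity: `U₀ = 1`,
`φ = 0`.  Count-neutral; N05 NOT discharged; no count claim; one finite `𝕋⁴` programme at fixed `ε`, Bałaban as printed; the YM mass gap (Clay) is NOT proved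
by any of this — R4 closes the conditional finite-`𝕋⁴` rung `BalabanLadder.UV` only; nothing continuum ∕ ℝ⁴ ∕ OS.  No `sorry`, no `def`, no `instance`, no
`notation`.  Unit `pub-ymgap-dag-n05-w3` (g2), 2026-08-28.
-/

noncomputable section

namespace Literature.MathematicalPhysics.QuantumFieldTheory.Balaban1983to89.B8Ineq159CurvedCubeMemberSmallPlaquettesTower

open B7Prop1Explicit B7Prop2Explicit B7Prop1Local
open B7Eq78Linearization (conjR conjR_apply conjR_smul)
open B7Prop4GeneralLevels (linCovIter)
open B8Ineq132 (covDerivFwd covDeriv BondTouches norm_conjR InAk)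
open B8Eq140Level (SideTouches)
open B8Eq146AExpansion (iEta)
open B8Eq155JBound (Jcur)
open B8Eq138LandauZd (IsLandau138 covLap covDivB QT)
open B8Eq131Cubes (sqLo sqHi)
open B8Eq131CubesAdmissible (cubeFam)
open B8CubeMemberZd (cubeLamS)
open B8Ineq159FlatCubeMemberPrinted (cubeLamBP)
open B8Lemma1NonAbelian (lowPart axial_bond_bound_sharp)
open B9Eq340HolderZd (covDerivFwd_gaugeAct)
open B9Eq332FieldAvgCovariance (linCovIter_rot)
open B9Eq332AvgCovariance (conjR_inv_conjR)
open B8Eq115GaugeFixing (gaugeAct_mem_of)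
open B8Ineq159GaugeCovariance (Jcur_gaugeAct covLap_gaugeAct isLandau138_gaugeAct_iff)
open B8Ineq159CurvedCubeMemberSmallPlaquettes (gaugeAct_inv_gaugeAct l1_le_of_le)
open B8Ineq159CurvedCubeMemberLocalTower (exists_curved159_perCube_local)
open B8Ineq159CurvedCubeMemberInAk (plaqSmall_of_inAk)

-- `Site` alone would resolve to the torus sites of `Setup.lean`; re-export the `ℤ^d` sites of `B7Prop1Explicit`.
export B7Prop1Explicit (Site)

variable {d : ℕ}

section General

variable {𝔸 : Type*} [NormedRing 𝔸] [NormOneClass 𝔸] [NormedAlgebra ℂ 𝔸] [CompleteSpace 𝔸]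

/-! ## §1 File (F′) along a gauge transformation -/

/-- ★ **File (F′) along a gauge transformation**: with the same `δ₀(□, m), B′(□, m)` as `exists_curved159_perCube_local`, for every `U1`-valued gauge function
`u` and every `G`-valued `V` that is `δ₀`-close to `1` on the bonds based in `[sqLo₀ − (Lᵐ+3)𝟙, sqHi₀ + (Lᵐ+3)𝟙]`, the conclusion of (F′) holds at the
background `V^u` (transport `φ ↦ R(u)⁻¹φ`: data and targets are rotated by unit-bounded `R(·)`, `B8Ineq132.norm_conjR`; the Landau condition by
`isLandau138_gaugeAct_iff`; the averages by `linCovIter_rot`; the current and the Laplacian by `Jcur_gaugeAct`, `covLap_gaugeAct`).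
[cite: Balaban1985RegularSpaces, (1.59) p.86, p.77 (gauge invariance), (1.11) p.78, (1.38) p.82; Balaban1985BackgroundPropagators, (3.32) p.395; Balaban1985Averaging, (11) p.19, Prop. 2 (52)–(54) p.26] -/
theorem exists_curved159_perCube_local_gauge [FiniteDimensional ℂ 𝔸] (hd2 : 2 ≤ d) {L : ℕ} (hL2 : 2 ≤ L) {η : ℝ} (hη : 0 < η)
    {G : Subgroup 𝔸ˣ} (hG : AvgClosed d L G) (a : Site d) (M : ℕ) {ρ : ℕ} (hρ : L ≤ ρ) {k m : ℕ} (hm1 : 1 ≤ m) (hmk : m ≤ k) :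
    ∃ δ₀ B' : ℝ, 0 < δ₀ ∧ 0 < B' ∧ ∀ (u : Site d → 𝔸ˣ), (∀ x, u x ∈ U1 𝔸) →
      ∀ (V : Site d → Fin d → 𝔸ˣ), (∀ x κ, V x κ ∈ G) →
      (∀ (x : Site d) (κ : Fin d),
          InBox (sqLo L a ρ k 0 - (((L : ℤ) ^ m) + 3) • (1 : Site d)) (sqHi L a M ρ k 0 + (((L : ℤ) ^ m) + 3) • (1 : Site d)) x →
          ‖((V x κ : 𝔸ˣ) : 𝔸) - 1‖ ≤ δ₀) →
      ∀ φ : Site d → Fin d → 𝔸,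
        IsLandau138 L m η (cubeFam false L a M ρ k 0) (cubeLamS L a M ρ k m) (gaugeAct u V) φ →
        (∀ (y : Site d) (τ : Fin d), (∀ j, j ≤ m → ¬ SideTouches (cubeFam false L a M ρ k j) y τ) → φ y τ = 0) →
        ∀ N : ℝ, 0 ≤ N →
          (∀ j, j ≤ m → ∀ (y : Site d) (τ : Fin d), BondTouches (cubeFam false L a M ρ k j) y τ →
              ((L : ℝ) ^ j * η) ^ 3 * ‖Jcur η (gaugeAct u V) φ τ y‖ ≤ N) →
          (∀ j, j ≤ m → ∀ c ∈ cubeLamBP L a M ρ k m j, ‖linCovIter L (gaugeAct u V) (iEta η φ) j c.1 c.2‖ ≤ N) →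
          (∀ (y : Site d) (τ : Fin d), ¬ BondTouches (cubeFam false L a M ρ k 0) y τ → η * ‖φ y τ‖ ≤ N) →
          ∀ j, j ≤ m → ∀ (y : Site d) (τ : Fin d), SideTouches (cubeFam false L a M ρ k j) y τ →
            ((L : ℝ) ^ j * η) * ‖φ y τ‖ ≤ B' * N ∧
            (∀ ν : Fin d, ((L : ℝ) ^ j * η) ^ 2 * ‖covDerivFwd η (gaugeAct u V) ν (fun z => φ z τ) y‖ ≤ B' * N) ∧
            ((L : ℝ) ^ j * η) ^ 3 * ‖covLap η (gaugeAct u V) (fun z => φ z τ) y‖ ≤ B' * N := by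
  obtain ⟨δ₀, B', hδ₀, hB', H⟩ := exists_curved159_perCube_local (𝔸 := 𝔸) hd2 hL2 hη hG a M hρ hm1 hmk
  refine ⟨δ₀, B', hδ₀, hB', ?_⟩
  intro u hu V hV hδ φ hLan hs N hN h1 h2 h3 j hj y τ hst
  set A : Site d → Fin d → 𝔸 := fun z κ => conjR (u z)⁻¹ (φ z κ) with hA
  have hφA : φ = fun z κ => conjR (u z) (A z κ) := by
    funext z κ
    rw [hA]
    exact (conjR_inv_conjR (u z)⁻¹ (φ z κ)).symm.trans (by rw [inv_inv])
  have hnA : ∀ z κ, ‖A z κ‖ = ‖φ z κ‖ := fun z κ => by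
    rw [hA]; exact norm_conjR ((U1 𝔸).inv_mem (hu z)) _
  have hLanA : IsLandau138 L m η (cubeFam false L a M ρ k 0) (cubeLamS L a M ρ k m) V A := by
    rw [hφA] at hLan
    exact (isLandau138_gaugeAct_iff L u V m η _ _ A).1 hLan
  have hsA : ∀ (y : Site d) (τ : Fin d), (∀ j, j ≤ m → ¬ SideTouches (cubeFam false L a M ρ k j) y τ) → A y τ = 0 := by
    intro y' τ' h
    rw [hA]
    show conjR (u y')⁻¹ (φ y' τ') = 0
    rw [hs y' τ' h, conjR_apply, mul_zero, zero_mul]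
  have h1A : ∀ j, j ≤ m → ∀ (y : Site d) (τ : Fin d), BondTouches (cubeFam false L a M ρ k j) y τ →
      ((L : ℝ) ^ j * η) ^ 3 * ‖Jcur η V A τ y‖ ≤ N := by
    intro j' hj' y' τ' hbt
    have e : ‖Jcur η (gaugeAct u V) φ τ' y'‖ = ‖Jcur η V A τ' y'‖ := by
      rw [hφA, Jcur_gaugeAct]; exact norm_conjR (hu y') _
    rw [← e]; exact h1 j' hj' y' τ' hbt
  have h2A : ∀ j, j ≤ m → ∀ c ∈ cubeLamBP L a M ρ k m j, ‖linCovIter L V (iEta η A) j c.1 c.2‖ ≤ N := by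
    intro j' hj' c hc
    have hi : iEta η φ = fun z κ => conjR (u z) (iEta η A z κ) := by
      funext z κ
      rw [hφA]
      simp only [B8Eq146AExpansion.iEta_def, conjR_smul]
    have e : ‖linCovIter L (gaugeAct u V) (iEta η φ) j' c.1 c.2‖ = ‖linCovIter L V (iEta η A) j' c.1 c.2‖ := by
      rw [hi, linCovIter_rot]
      exact norm_conjR (hu _) _
    rw [← e]; exact h2 j' hj' c hc
  have h3A : ∀ (y : Site d) (τ : Fin d), ¬ BondTouches (cubeFam false L a M ρ k 0) y τ → η * ‖A y τ‖ ≤ N := by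
    intro y' τ' h; rw [hnA]; exact h3 y' τ' h
  obtain ⟨t1, t2, t3⟩ := H V hV hδ A hLanA hsA N hN h1A h2A h3A j hj y τ hst
  refine ⟨by rw [← hnA]; exact t1, fun ν => ?_, ?_⟩
  · have e : ‖covDerivFwd η (gaugeAct u V) ν (fun z => φ z τ) y‖ = ‖covDerivFwd η V ν (fun z => A z τ) y‖ := by
      rw [covDerivFwd_gaugeAct η u V ν (F := fun z => A z τ) (fun z => by rw [hφA])]
      exact norm_conjR (hu y) _
    rw [e]; exact t2 ν
  · have e : ‖covLap η (gaugeAct u V) (fun z => φ z τ) y‖ = ‖covLap η V (fun z => A z τ) y‖ := by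
      have hfun : (fun z => φ z τ) = fun z => conjR (u z) (A z τ) := by funext z; rw [hφA]
      rw [hfun, covLap_gaugeAct]
      exact norm_conjR (hu y) _
    rw [e]; exact t3

/-! ## §2 The per-member curved (1.59) at all truncations for backgrounds with small plaquettes on a box around `□₀` -/

/-- ★★★ **(1.59) AT A SMALL-FIELD BACKGROUND ON THE CUBE MEMBER, PER MEMBER, ALL TRUNCATIONS `1 ≤ m ≤ k`.**  For `d ≥ 2`, `2 ≤ L ≤ ρ`, `η > 0`, a cube datum
`(a, M, ρ, k)`, a truncation `1 ≤ m ≤ k`, `𝔸` a finite-dimensional complete normed `ℂ`-algebra and `G` an averaging-closed gauge group ([B7] Prop. 2's regime,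
`AvgClosed d L G`; the unitary group of a C⋆-algebra qualifies), THERE ARE `a₀ > 0` and `B′ > 0` (depending on the member, `m` and `𝔸`) such that: for every
`G`-valued background `U₀` whose plaquette variables on the box `[sqLo₀ − (Lᵐ+4)𝟙, sqHi₀ + (Lᵐ+4)𝟙]` are `a₀`-close to `1` (`B8Lemma1NonAbelian.PlaqSmall`,
p. 77's (1.7) on a neighbourhood of `□₀`), every `𝔸`-valued `φ` in the CURVED Landau gauge (1.38) of `U₀` at truncation `m` (multiplier form, `Λ′`-tower
`cubeLamS … m`) supported on the side-touching bonds of the `□_j`, `j ≤ m`, and every `N ≥ 0` bounding (i) `(Lʲη)³|J_{U₀}(φ)|` on the bonds of `□_j`, (ii) the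
curved averages `|Lʲη·Q_j(U₀)(iηφ)(c)|` on print's class `cubeLamBP … m j`, (iii) `η|φ|` on the outer layer — on every bond side-touching `□_j`, `j ≤ m`:
`(Lʲη)|φ| ≤ B′N`, `(Lʲη)²|D^η_{U₀,ν}φ_τ| ≤ B′N` (all `ν`), `(Lʲη)³|Δ^η_{U₀}φ_τ| ≤ B′N` — print's «|A|₍₋₁₎, |∇^η_{U₀}A|₍₋₂₎, |Δ^η_{U₀}A|₍₋₃₎ ≦ B₀(|J|₍₋₃₎ +
|B₁|)» in the pointwise form (1.62), member- and truncation-dependent constant.  PROOF: Lemma 1's axial gauge `w = U₀(Γ_{lo,·})` based at the box corner is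
`G`-valued, `U₀^w` is `G`-valued and bondwise `l1(box)·a₀ ≤ δ₀(□, m)`-close to `1` on the box (`axial_bond_bound_sharp`); `U₀ = (U₀^w)^{w⁻¹}`; §1.
HONEST SCOPE in the module docstring (per member ∕ truncation, plaquette box ⊋ `□₀`, not `𝔄_k` verbatim, not a socket inhabitant, not [4] Thm 3.3).
[cite: Balaban1985RegularSpaces, (1.59) p.86, (1.62) p.87, p.77, (1.7) p.77, Lemma 1 p.79, (1.38) p.82, (1.131) p.99; Balaban1985Averaging, p.24, (8) p.18, Prop. 2 (52)–(54) p.26; Balaban1985BackgroundPropagators, Thm 3.3 p.399, (3.32) p.395] -/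
theorem exists_curved159_perCube_smallPlaquettes_tower [FiniteDimensional ℂ 𝔸] (hd2 : 2 ≤ d) {L : ℕ} (hL2 : 2 ≤ L) {η : ℝ} (hη : 0 < η)
    {G : Subgroup 𝔸ˣ} (hG : AvgClosed d L G) (a : Site d) (M : ℕ) {ρ : ℕ} (hρ : L ≤ ρ) {k m : ℕ} (hm1 : 1 ≤ m) (hmk : m ≤ k) :
    ∃ a₀ B' : ℝ, 0 < a₀ ∧ 0 < B' ∧ ∀ (U₀ : Site d → Fin d → 𝔸ˣ), (∀ x κ, U₀ x κ ∈ G) →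
      B8Lemma1NonAbelian.PlaqSmall U₀ (sqLo L a ρ k 0 - (((L : ℤ) ^ m) + 4) • (1 : Site d))
        (sqHi L a M ρ k 0 + (((L : ℤ) ^ m) + 4) • (1 : Site d)) a₀ →
      ∀ φ : Site d → Fin d → 𝔸,
        IsLandau138 L m η (cubeFam false L a M ρ k 0) (cubeLamS L a M ρ k m) U₀ φ →
        (∀ (y : Site d) (τ : Fin d), (∀ j, j ≤ m → ¬ SideTouches (cubeFam false L a M ρ k j) y τ) → φ y τ = 0) →
        ∀ N : ℝ, 0 ≤ N →
          (∀ j, j ≤ m → ∀ (y : Site d) (τ : Fin d), BondTouches (cubeFam false L a M ρ k j) y τ →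
              ((L : ℝ) ^ j * η) ^ 3 * ‖Jcur η U₀ φ τ y‖ ≤ N) →
          (∀ j, j ≤ m → ∀ c ∈ cubeLamBP L a M ρ k m j, ‖linCovIter L U₀ (iEta η φ) j c.1 c.2‖ ≤ N) →
          (∀ (y : Site d) (τ : Fin d), ¬ BondTouches (cubeFam false L a M ρ k 0) y τ → η * ‖φ y τ‖ ≤ N) →
          ∀ j, j ≤ m → ∀ (y : Site d) (τ : Fin d), SideTouches (cubeFam false L a M ρ k j) y τ →
            ((L : ℝ) ^ j * η) * ‖φ y τ‖ ≤ B' * N ∧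
            (∀ ν : Fin d, ((L : ℝ) ^ j * η) ^ 2 * ‖covDerivFwd η U₀ ν (fun z => φ z τ) y‖ ≤ B' * N) ∧
            ((L : ℝ) ^ j * η) ^ 3 * ‖covLap η U₀ (fun z => φ z τ) y‖ ≤ B' * N := by
  obtain ⟨δ₀, B', hδ₀, hB', H⟩ := exists_curved159_perCube_local_gauge (𝔸 := 𝔸) hd2 hL2 hη hG a M hρ hm1 hmk
  -- the radius, the plaquette box and its `|·|₁`-diameter
  obtain ⟨R, hR⟩ : ∃ R : ℤ, R = (L : ℤ) ^ m := ⟨_, rfl⟩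
  obtain ⟨lo, hlo⟩ : ∃ lo : Site d, lo = sqLo L a ρ k 0 - (((L : ℤ) ^ m) + 4) • (1 : Site d) := ⟨_, rfl⟩
  obtain ⟨hi, hhi⟩ : ∃ hi : Site d, hi = sqHi L a M ρ k 0 + (((L : ℤ) ^ m) + 4) • (1 : Site d) := ⟨_, rfl⟩
  have hlo_i : ∀ i, lo i = sqLo L a ρ k 0 i - (R + 4) := fun i => by
    rw [hlo, hR]; simp only [Pi.sub_apply, Pi.smul_apply, Pi.one_apply, smul_eq_mul, mul_one]
  have hhi_i : ∀ i, hi i = sqHi L a M ρ k 0 i + (R + 4) := fun i => by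
    rw [hhi, hR]; simp only [Pi.add_apply, Pi.smul_apply, Pi.one_apply, smul_eq_mul, mul_one]
  obtain ⟨D, hD⟩ : ∃ D : ℕ, D = l1 (hi - lo) := ⟨_, rfl⟩
  obtain ⟨a₀, ha₀⟩ : ∃ a₀ : ℝ, a₀ = δ₀ / ((D : ℝ) + 1) := ⟨_, rfl⟩
  have ha₀pos : 0 < a₀ := by rw [ha₀]; positivity
  have hDa : (D : ℝ) * a₀ ≤ δ₀ := by
    rw [ha₀, mul_div_assoc']
    rw [div_le_iff₀ (by positivity)]
    nlinarith [hδ₀.le]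
  refine ⟨a₀, B', ha₀pos, hB', ?_⟩
  intro U₀ hU hP φ hLan hs N hN h1 h2 h3 j hj y τ hst
  have hU1 : ∀ x κ, U₀ x κ ∈ U1 𝔸 := fun x κ => hG.le_U1 (hU x κ)
  rw [← hlo, ← hhi] at hP
  -- Lemma 1's axial gauge based at the corner `lo`: `G`-valued
  set w : Site d → 𝔸ˣ := axialFn U₀ lo with hw
  have hwG : ∀ x, w x ∈ G := fun x => hol_mem_of hU _ _
  have hwU : ∀ x, w x ∈ U1 𝔸 := fun x => hG.le_U1 (hwG x)
  set V : Site d → Fin d → 𝔸ˣ := gaugeAct w U₀ with hVdef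
  have hV : ∀ x κ, V x κ ∈ G := fun x κ => gaugeAct_mem_of hU hwG x κ
  have hUV : U₀ = gaugeAct w⁻¹ V := by rw [hVdef, gaugeAct_inv_gaugeAct]
  -- `V` is `δ₀`-close to `1` on the bonds based in the (smaller) box of file (F′)
  have hclose : ∀ (x : Site d) (κ : Fin d),
      InBox (sqLo L a ρ k 0 - (((L : ℤ) ^ m) + 3) • (1 : Site d)) (sqHi L a M ρ k 0 + (((L : ℤ) ^ m) + 3) • (1 : Site d)) x →
      ‖((V x κ : 𝔸ˣ) : 𝔸) - 1‖ ≤ δ₀ := by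
    intro x κ hx
    have hx' : ∀ i, sqLo L a ρ k 0 i - (R + 3) ≤ x i ∧ x i ≤ sqHi L a M ρ k 0 i + (R + 3) := fun i => by
      have := hx i
      rw [← hR] at this
      simp only [Pi.sub_apply, Pi.add_apply, Pi.smul_apply, Pi.one_apply, smul_eq_mul, mul_one] at this
      exact this
    have hlox : lo ≤ x := fun i => by rw [hlo_i]; linarith [(hx' i).1]
    have hxhi : x + e κ ≤ hi := fun i => by
      rw [hhi_i, Pi.add_apply, e_apply]; split_ifs <;> linarith [(hx' i).2]
    have hb := axial_bond_bound_sharp U₀ hU1 hP lo x κ le_rfl hlox hxhi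
    have hl1 : (l1 (lowPart κ (x - lo)) : ℝ) ≤ D := by
      rw [hD]
      exact_mod_cast l1_le_of_le (B8Lemma1NonAbelian.lowPart_nonneg κ (sub_nonneg.mpr hlox))
        ((B8Lemma1NonAbelian.lowPart_le_self κ (sub_nonneg.mpr hlox)).trans (fun i => by
          have h1 := hxhi i
          have h2 : (0 : ℤ) ≤ e κ i := by rw [e_apply]; split_ifs <;> norm_num
          rw [Pi.add_apply] at h1
          simp only [Pi.sub_apply]
          linarith))
    calc ‖((V x κ : 𝔸ˣ) : 𝔸) - 1‖ ≤ l1 (lowPart κ (x - lo)) * a₀ := hb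
      _ ≤ D * a₀ := mul_le_mul_of_nonneg_right hl1 ha₀pos.le
      _ ≤ δ₀ := hDa
  -- file (F′) along the inverse axial gauge
  rw [hUV] at hLan h1 h2 ⊢
  exact H w⁻¹ (fun x => (U1 𝔸).inv_mem (hwU x)) V hV hclose φ hLan hs N hN h1 h2 h3 j hj y τ hst

/-! ## §3 Re-keying: `U₀ ∈ 𝔄_k({Ω_j}, α₀)` with `Ω₀ ⊇ □₀ + (Lᵐ+4)` -/

/-- ★ **(1.59) «FOR `U₀ ∈ 𝔄_k({Ω_j}, α₀)`» ON THE CUBE MEMBER, PER MEMBER, ALL TRUNCATIONS `1 ≤ m ≤ k`** (`G`-valued backgrounds, [B7] Prop. 2's regime): as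
`exists_curved159_perCube_smallPlaquettes_tower`, the plaquette hypothesis replaced by `B8Ineq132.InAk L k′ η α₀ Ω U₀` for ANY sequence `{Ω_j}` whose `Ω₀`
contains the box `[sqLo₀ − (Lᵐ+4)𝟙, sqHi₀ + (Lᵐ+4)𝟙]` and any `k′` (only the level-`0` plaquette clause of (1.7) is used, file (H)'s `plaqSmall_of_inAk`).
HONEST SCOPE: the containment is a stated side condition (print: `□₀ ⊂ Ω₀` with the `R₁M₁`-collars of p. 98); per member ∕ truncation; NOT [4] Thm 3.3.
[cite: Balaban1985RegularSpaces, (1.59) p.86, (1.62) p.87, (1.7) p.77, (1.27)–(1.29) p.81, p.98, (1.38) p.82, (1.131) p.99; Balaban1985Averaging, Prop. 2 (52)–(54) p.26; Balaban1985BackgroundPropagators, Thm 3.3 p.399] -/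
theorem exists_curved159_perCube_inAk_tower [FiniteDimensional ℂ 𝔸] (hd2 : 2 ≤ d) {L : ℕ} (hL2 : 2 ≤ L) {η : ℝ} (hη : 0 < η)
    {G : Subgroup 𝔸ˣ} (hG : AvgClosed d L G) (a : Site d) (M : ℕ) {ρ : ℕ} (hρ : L ≤ ρ) {k m : ℕ} (hm1 : 1 ≤ m) (hmk : m ≤ k) :
    ∃ α₀ B' : ℝ, 0 < α₀ ∧ 0 < B' ∧ ∀ (U₀ : Site d → Fin d → 𝔸ˣ), (∀ x κ, U₀ x κ ∈ G) →
      ∀ (Ω : ℕ → Set (Site d)) (k' : ℕ),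
        (∀ x, InBox (sqLo L a ρ k 0 - (((L : ℤ) ^ m) + 4) • (1 : Site d)) (sqHi L a M ρ k 0 + (((L : ℤ) ^ m) + 4) • (1 : Site d)) x →
          x ∈ Ω 0) →
        InAk L k' η α₀ Ω U₀ →
      ∀ φ : Site d → Fin d → 𝔸,
        IsLandau138 L m η (cubeFam false L a M ρ k 0) (cubeLamS L a M ρ k m) U₀ φ →
        (∀ (y : Site d) (τ : Fin d), (∀ j, j ≤ m → ¬ SideTouches (cubeFam false L a M ρ k j) y τ) → φ y τ = 0) →
        ∀ N : ℝ, 0 ≤ N →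
          (∀ j, j ≤ m → ∀ (y : Site d) (τ : Fin d), BondTouches (cubeFam false L a M ρ k j) y τ →
              ((L : ℝ) ^ j * η) ^ 3 * ‖Jcur η U₀ φ τ y‖ ≤ N) →
          (∀ j, j ≤ m → ∀ c ∈ cubeLamBP L a M ρ k m j, ‖linCovIter L U₀ (iEta η φ) j c.1 c.2‖ ≤ N) →
          (∀ (y : Site d) (τ : Fin d), ¬ BondTouches (cubeFam false L a M ρ k 0) y τ → η * ‖φ y τ‖ ≤ N) →
          ∀ j, j ≤ m → ∀ (y : Site d) (τ : Fin d), SideTouches (cubeFam false L a M ρ k j) y τ →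
            ((L : ℝ) ^ j * η) * ‖φ y τ‖ ≤ B' * N ∧
            (∀ ν : Fin d, ((L : ℝ) ^ j * η) ^ 2 * ‖covDerivFwd η U₀ ν (fun z => φ z τ) y‖ ≤ B' * N) ∧
            ((L : ℝ) ^ j * η) ^ 3 * ‖covLap η U₀ (fun z => φ z τ) y‖ ≤ B' * N := by
  obtain ⟨a₀, B', ha₀, hB', H⟩ := exists_curved159_perCube_smallPlaquettes_tower (𝔸 := 𝔸) hd2 hL2 hη hG a M hρ hm1 hmk
  exact ⟨a₀, B', ha₀, hB', fun U₀ hU Ω k' hΩ hAk => H U₀ hU (plaqSmall_of_inAk hAk hΩ)⟩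

end General

/-! ## §4 C⋆-algebras: unitary-valued backgrounds ([B7] (42)–(43), (22)–(23): `U(𝔸)` is averaging-closed) -/

section Unitary

variable {𝔸 : Type*} [CStarAlgebra 𝔸] [Nontrivial 𝔸]

/-- ★ **(1.59) AT A SMALL-FIELD UNITARY BACKGROUND ON THE CUBE MEMBER, PER MEMBER, ALL TRUNCATIONS** (C⋆-algebra coefficients):
`exists_curved159_perCube_smallPlaquettes_tower` at `G := U(𝔸)` (`B7Prop2Explicit.avgClosed_unitaryUnits`) — for every UNITARY-valued `U₀` with `a₀(□, m)`-small
plaquettes on the box `□₀ + (Lᵐ+4)`, the all-truncations curved (1.59) conclusion.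
[cite: Balaban1985RegularSpaces, (1.59) p.86, (1.7) p.77, Lemma 1 p.79, (1.38) p.82; Balaban1985Averaging, (42)–(43) pp.23–24, (22)–(23) p.21, Prop. 2 (52)–(54) p.26; Balaban1985BackgroundPropagators, Thm 3.3 p.399] -/
theorem exists_curved159_perCube_unitary_smallPlaquettes [FiniteDimensional ℂ 𝔸] (hd2 : 2 ≤ d) {L : ℕ} (hL2 : 2 ≤ L) {η : ℝ} (hη : 0 < η)
    (a : Site d) (M : ℕ) {ρ : ℕ} (hρ : L ≤ ρ) {k m : ℕ} (hm1 : 1 ≤ m) (hmk : m ≤ k) :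
    ∃ a₀ B' : ℝ, 0 < a₀ ∧ 0 < B' ∧ ∀ (U₀ : Site d → Fin d → 𝔸ˣ), (∀ x κ, U₀ x κ ∈ unitaryUnits 𝔸) →
      B8Lemma1NonAbelian.PlaqSmall U₀ (sqLo L a ρ k 0 - (((L : ℤ) ^ m) + 4) • (1 : Site d))
        (sqHi L a M ρ k 0 + (((L : ℤ) ^ m) + 4) • (1 : Site d)) a₀ →
      ∀ φ : Site d → Fin d → 𝔸,
        IsLandau138 L m η (cubeFam false L a M ρ k 0) (cubeLamS L a M ρ k m) U₀ φ →
        (∀ (y : Site d) (τ : Fin d), (∀ j, j ≤ m → ¬ SideTouches (cubeFam false L a M ρ k j) y τ) → φ y τ = 0) →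
        ∀ N : ℝ, 0 ≤ N →
          (∀ j, j ≤ m → ∀ (y : Site d) (τ : Fin d), BondTouches (cubeFam false L a M ρ k j) y τ →
              ((L : ℝ) ^ j * η) ^ 3 * ‖Jcur η U₀ φ τ y‖ ≤ N) →
          (∀ j, j ≤ m → ∀ c ∈ cubeLamBP L a M ρ k m j, ‖linCovIter L U₀ (iEta η φ) j c.1 c.2‖ ≤ N) →
          (∀ (y : Site d) (τ : Fin d), ¬ BondTouches (cubeFam false L a M ρ k 0) y τ → η * ‖φ y τ‖ ≤ N) →
          ∀ j, j ≤ m → ∀ (y : Site d) (τ : Fin d), SideTouches (cubeFam false L a M ρ k j) y τ →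
            ((L : ℝ) ^ j * η) * ‖φ y τ‖ ≤ B' * N ∧
            (∀ ν : Fin d, ((L : ℝ) ^ j * η) ^ 2 * ‖covDerivFwd η U₀ ν (fun z => φ z τ) y‖ ≤ B' * N) ∧
            ((L : ℝ) ^ j * η) ^ 3 * ‖covLap η U₀ (fun z => φ z τ) y‖ ≤ B' * N :=
  exists_curved159_perCube_smallPlaquettes_tower (𝔸 := 𝔸) hd2 hL2 hη (avgClosed_unitaryUnits d L) a M hρ hm1 hmk

/-- ★ **(1.59) «FOR `U₀ ∈ 𝔄_k({Ω_j}, α₀)`», UNITARY BACKGROUNDS, ALL TRUNCATIONS** (C⋆-algebra coefficients): `exists_curved159_perCube_inAk_tower` at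
`G := U(𝔸)`.  HONEST SCOPE as there (`Ω₀ ⊇ □₀ + (Lᵐ+4)` stated; per member ∕ truncation; NOT [4] Thm 3.3).
[cite: Balaban1985RegularSpaces, (1.59) p.86, (1.7) p.77, (1.27)–(1.29) p.81, (1.38) p.82; Balaban1985Averaging, (42)–(43) pp.23–24, Prop. 2 (52)–(54) p.26; Balaban1985BackgroundPropagators, Thm 3.3 p.399] -/
theorem exists_curved159_perCube_unitary_inAk [FiniteDimensional ℂ 𝔸] (hd2 : 2 ≤ d) {L : ℕ} (hL2 : 2 ≤ L) {η : ℝ} (hη : 0 < η)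
    (a : Site d) (M : ℕ) {ρ : ℕ} (hρ : L ≤ ρ) {k m : ℕ} (hm1 : 1 ≤ m) (hmk : m ≤ k) :
    ∃ α₀ B' : ℝ, 0 < α₀ ∧ 0 < B' ∧ ∀ (U₀ : Site d → Fin d → 𝔸ˣ), (∀ x κ, U₀ x κ ∈ unitaryUnits 𝔸) →
      ∀ (Ω : ℕ → Set (Site d)) (k' : ℕ),
        (∀ x, InBox (sqLo L a ρ k 0 - (((L : ℤ) ^ m) + 4) • (1 : Site d)) (sqHi L a M ρ k 0 + (((L : ℤ) ^ m) + 4) • (1 : Site d)) x →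
          x ∈ Ω 0) →
        InAk L k' η α₀ Ω U₀ →
      ∀ φ : Site d → Fin d → 𝔸,
        IsLandau138 L m η (cubeFam false L a M ρ k 0) (cubeLamS L a M ρ k m) U₀ φ →
        (∀ (y : Site d) (τ : Fin d), (∀ j, j ≤ m → ¬ SideTouches (cubeFam false L a M ρ k j) y τ) → φ y τ = 0) →
        ∀ N : ℝ, 0 ≤ N →
          (∀ j, j ≤ m → ∀ (y : Site d) (τ : Fin d), BondTouches (cubeFam false L a M ρ k j) y τ →
              ((L : ℝ) ^ j * η) ^ 3 * ‖Jcur η U₀ φ τ y‖ ≤ N) →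
          (∀ j, j ≤ m → ∀ c ∈ cubeLamBP L a M ρ k m j, ‖linCovIter L U₀ (iEta η φ) j c.1 c.2‖ ≤ N) →
          (∀ (y : Site d) (τ : Fin d), ¬ BondTouches (cubeFam false L a M ρ k 0) y τ → η * ‖φ y τ‖ ≤ N) →
          ∀ j, j ≤ m → ∀ (y : Site d) (τ : Fin d), SideTouches (cubeFam false L a M ρ k j) y τ →
            ((L : ℝ) ^ j * η) * ‖φ y τ‖ ≤ B' * N ∧
            (∀ ν : Fin d, ((L : ℝ) ^ j * η) ^ 2 * ‖covDerivFwd η U₀ ν (fun z => φ z τ) y‖ ≤ B' * N) ∧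
            ((L : ℝ) ^ j * η) ^ 3 * ‖covLap η U₀ (fun z => φ z τ) y‖ ≤ B' * N :=
  exists_curved159_perCube_inAk_tower (𝔸 := 𝔸) hd2 hL2 hη (avgClosed_unitaryUnits d L) a M hρ hm1 hmk

end Unitary

end Literature.MathematicalPhysics.QuantumFieldTheory.Balaban1983to89.B8Ineq159CurvedCubeMemberSmallPlaquettesTower

end
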